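import Mathlib.CategoryTheory.Comma.Over.Basic
import Mathlib.CategoryTheory.Adjunction.Basic
import Mathlib.Topology.Algebra.OpenSubgroup
import Mathlib.FieldTheory.AbsoluteGaloisGroup
import Literature.AnabelianGeometry.SemiGraphs.TemperedGroups
import Literature.AlgebraicGeometry.Frobenioids.Categories
import Literature.AlgebraicGeometry.Frobenioids.CategoriesFactorization
import Literature.AlgebraicGeometry.Frobenioids.Dissection
import HarnessLib

/-!
# Frobenioids II, Example 1.3: connected quasi-temperoids

Mochizuki, *The geometry of Frobenioids II*, Kyushu J. Math. **62** (2008) 401–460, §1 Example 1.3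
"Connected Quasi-temperoids" (i)–(iii), author's text pp. 10–12
[cite: MochizukiFrdII2008, Ex 1.3 pp.10-12] — the base categories `D = B^temp(Π, Π°)⁰` over which
the `p`-adic Frobenioids of Example 1.1 (ii) are taken in §2 and in IUT ([IUTchI] uses exactly
these bases, "`D_v := B^temp(Π_v)⁰`").

**Reused, not re-declared.** `B^temp(Π)` (`BTemp`), tempered groups (`IsTempered`), Remark 3.1.1
"profinite ⇒ tempered", the quotient objects `Π/H` and the pull-back functor `BTemp.res` are
L3's `Literature.AnabelianGeometry.SemiGraphs.TemperedGroups` ([SemiAnbd] §3); "temp-slim" is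
`IsSlimGroup` of `Categories.lean` (identified with [SemiAnbd] Def. 3.4 (ii) there); `C⁰` is
`ConnectedPart`; "connected temperoid" ([SemiAnbd] Def. 3.1 (ii)) is L3's and is only quoted in
docstrings here. NEW in [FrdII] Ex. 1.3 and typed here: the full subcategory `B^temp(Π, Π°)`, the
notion of a *connected quasi-temperoid* (= [SemiAnbd] Def. A.1 (i), recalled on p. 11), open
homomorphisms of tempered groups, and the printed claims of (i)–(iii) as named facts:
`B^temp(Π)⁰ ≃ B(Π)⁰` for profinite `Π`; `B^temp(Π°) ≃ B^temp(Π)_{Π/Π°}`; "`E⁰` is connected,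
totally epimorphic, of strongly indissectible type and of FSM-type, hence of FSMFF-type";
the functor `φ_*` and its adjunction to the pull-back functor for surjective `φ`; (iii) the functor
to `B^temp(G_F)⁰`. No statement is strengthened; "temp-slim iff `B^temp(Π)` slim" ([SemiAnbd]
Cor. 3.3) and "residually finite ⇒ `B^temp(Π)⁰` Frobenius-slim" ([FrdI] Rmk 3.1.2) are quoted
with their owners' locators and not re-typed.
-/

namespace Literature.AlgebraicGeometry.Frobenioids

open CategoryTheory Topology
open Literature.AnabelianGeometry.SemiGraphs

universe v' u' u

namespace QuasiTemperoid

section BTempRel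

variable (G : Type u) [Group G] [TopologicalSpace G]

/-- The object `Π/Π°` of `Action (Type) Π`: "the set of cosets `Π/Π°` equipped with its natural
`Π`-action from the left" (FrdII Ex. 1.3 (i), p. 11). [cite: MochizukiFrdII2008, Ex 1.3 (i) p.11] -/
abbrev cosetAction (H : Subgroup G) : Action (Type u) G := Action.ofMulAction G (G ⧸ H)

/-- For `Π` tempered and `Π° ⊆ Π` open, `Π/Π°` is an object of `B^temp(Π)` ([SemiAnbd] Rmk 3.1.2,
L3's `temperedAction_quotient_iff`). [cite: MochizukiFrdII2008, Ex 1.3 (i) p.11] -/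
def cosetObj [IsTopologicalGroup G] (hG : IsTempered G) (H : Subgroup G) (hH : IsOpen (H : Set G)) :
    BTemp G :=
  ⟨cosetAction G H, (temperedAction_quotient_iff hG H).mpr hH⟩

/-- The object property cutting `B^temp(Π, Π°)` out of `B^temp(Π)`: "objects that admit a morphism
to the object `Π/Π°`" (FrdII Ex. 1.3 (i), p. 11). [cite: MochizukiFrdII2008, Ex 1.3 (i) p.11] -/
def admitsHomToCoset (H : Subgroup G) : ObjectProperty (BTemp G) := fun X =>
  Nonempty (X.obj ⟶ cosetAction G H)

/-- `B^temp(Π, Π°) ⊆ B^temp(Π)`: the full subcategory of objects that admit a morphism to `Π/Π°`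
(FrdII Ex. 1.3 (i), p. 11). [cite: MochizukiFrdII2008, Ex 1.3 (i) p.11] -/
abbrev BTempRel (H : Subgroup G) : Type (u + 1) := (admitsHomToCoset G H).FullSubcategory

/-- "Thus, if `Π` is profinite, then … there is a natural equivalence of categories
`B^temp(Π)⁰ ≃ B(Π)⁰`" (FrdII Ex. 1.3 (i), p. 11; `B(Π)` = `BCat Π` of `Categories.lean`).
[cite: MochizukiFrdII2008, Ex 1.3 (i) p.11] -/
def ConnectedPartEquivOfProfinite : Prop :=
  IsTopologicalGroup G → CompactSpace G → TotallyDisconnectedSpace G →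
    Nonempty (ConnectedPart (BTemp G) ≌ ConnectedPart (BCat G))

/-- "Note that there is a natural equivalence of categories `B^temp(Π°) ≃ B^temp(Π)_{Π/Π°}`"
(FrdII Ex. 1.3 (i), p. 11) — induction from the open subgroup `Π°` identifies `Π°`-sets with
`Π`-sets over `Π/Π°`; "in particular, we obtain natural functors `B^temp(Π°) → B^temp(Π)`,
`B^temp(Π°)⁰ → B^temp(Π)⁰`" (compose with the forgetful functor of the slice).
[cite: MochizukiFrdII2008, Ex 1.3 (i) p.11] -/
def InductionEquivalence : Prop :=
  ∀ [IsTopologicalGroup G] (hG : IsTempered G) (H : Subgroup G) (hH : IsOpen (H : Set G)),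
    Nonempty (BTemp H ≌ Over (cosetObj G hG H hH))

end BTempRel

/-! ### Connected quasi-temperoids (Ex. 1.3 (i), p. 11) -/

section Quasi

variable (E : Type u') [Category.{v'} E]

/-- **Example 1.3 (i)** (FrdII p. 11): "A *connected quasi-temperoid* is a category that is
equivalent to a category of the form `B^temp(Π, Π°)`, where `Π` is a tempered topological group,
and `Π° ⊆ Π` is an open subgroup [cf. [SemiAnbd], Definition A.1, (i)]."
[cite: MochizukiFrdII2008, Ex 1.3 (i) p.11] -/
@[mk_iff] structure IsConnectedQuasiTemperoid : Prop where
  /-- a presentation `E ≃ B^temp(Π, Π°)` with `Π` tempered and `Π°` open exists -/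
  exists_equiv : ∃ (G : Type u) (_ : Group G) (_ : TopologicalSpace G) (_ : IsTopologicalGroup G)
    (H : Subgroup G), IsTempered G ∧ IsOpen (H : Set G) ∧ Nonempty (E ≌ BTempRel G H)

end Quasi

section Claims

variable (G : Type u) [Group G] [TopologicalSpace G]

/-- **Example 1.3 (i)**, claim (FrdII p. 11): for a connected quasi-temperoid `E` (here
`E = B^temp(Π, Π°)`), "the category `E⁰` is connected". [cite: MochizukiFrdII2008, Ex 1.3 (i) p.11] -/
def ConnectedPartIsConnected : Prop :=
  IsTopologicalGroup G → IsTempered G → ∀ H : Subgroup G, IsOpen (H : Set G) →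
    IsConnected (ConnectedPart (BTempRel G H))

/-- **Example 1.3 (i)**, claim (FrdII p. 11): "`E⁰` is … totally epimorphic".
[cite: MochizukiFrdII2008, Ex 1.3 (i) p.11] -/
def ConnectedPartIsTotallyEpimorphic : Prop :=
  IsTopologicalGroup G → IsTempered G → ∀ H : Subgroup G, IsOpen (H : Set G) →
    IsTotallyEpimorphic (ConnectedPart (BTempRel G H))

/-- **Example 1.3 (i)**, claim (FrdII p. 11): "`E⁰` is … of strongly indissectible type [cf. §0]".
[cite: MochizukiFrdII2008, Ex 1.3 (i) p.11] -/
def ConnectedPartIsOfStronglyIndissectibleType : Prop :=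
  IsTopologicalGroup G → IsTempered G → ∀ H : Subgroup G, IsOpen (H : Set G) →
    IsOfStronglyIndissectibleType (ConnectedPart (BTempRel G H))

/-- **Example 1.3 (i)**, claim (FrdII p. 11): "`E⁰` is … of FSM-type [indeed, every monomorphism of
`E⁰` is an isomorphism]". [cite: MochizukiFrdII2008, Ex 1.3 (i) p.11] -/
def ConnectedPartMonoIsIso : Prop :=
  IsTopologicalGroup G → IsTempered G → ∀ H : Subgroup G, IsOpen (H : Set G) →
    ∀ {X Y : ConnectedPart (BTempRel G H)} (f : X ⟶ Y), Mono f → IsIso f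

/-- "every monomorphism is an isomorphism" implies FSM-type (an FSM-morphism is in particular a
monomorphism), the inference "[indeed, …]" of FrdII p. 11. [cite: MochizukiFrdII2008, Ex 1.3 (i) p.11] -/
theorem isOfFSMType_of_mono_isIso {C : Type*} [Category C]
    (h : ∀ {X Y : C} (f : X ⟶ Y), Mono f → IsIso f) : IsOfFSMType C :=
  ⟨fun f hf => h f hf.2⟩

/-- **Example 1.3 (i)**, claim (FrdII p. 11): "`E⁰` is … of FSM-type, hence, in particular, of
FSMFF-type" — the implication is `IsOfFSMType.isOfFSMFFType` of `CategoriesFactorization.lean`; the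
statement for `E⁰ = B^temp(Π, Π°)⁰`. [cite: MochizukiFrdII2008, Ex 1.3 (i) p.11] -/
def ConnectedPartIsOfFSMFFType : Prop :=
  IsTopologicalGroup G → IsTempered G → ∀ H : Subgroup G, IsOpen (H : Set G) →
    IsOfFSMFFType (ConnectedPart (BTempRel G H))

/-- FSM-type implies FSMFF-type for `E⁰`: the printed "hence" (FrdII p. 11), from the two facts above.
[cite: MochizukiFrdII2008, Ex 1.3 (i) p.11] -/
theorem connectedPartIsOfFSMFFType_of (h : ConnectedPartMonoIsIso G) : ConnectedPartIsOfFSMFFType G :=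
  fun i hG H hH => (isOfFSMType_of_mono_isIso (@h i hG H hH)).isOfFSMFFType

end Claims

/-! ### Example 1.3 (ii): open homomorphisms and the functor `φ_*` (p. 11) -/

section OpenHom

variable {G₁ : Type u} [Group G₁] [TopologicalSpace G₁] {G₂ : Type u} [Group G₂] [TopologicalSpace G₂]

/-- **Example 1.3 (ii)** (FrdII p. 11): `φ : Π₁ → Π₂` is an *open homomorphism* of topological groups:
"`φ` is a continuous homomorphism, `φ(Π₁)` is an open subgroup of `Π₂`, and `φ` induces an
isomorphism of topological groups `Π₁/Ker(φ) ≃ φ(Π₁)`" — equivalently, `φ` is continuous and an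
open map (an open map has open image and is a quotient map onto it).
[cite: MochizukiFrdII2008, Ex 1.3 (ii) p.11] -/
@[mk_iff] structure IsOpenHom (φ : G₁ →* G₂) : Prop where
  /-- `φ` is continuous -/
  continuous : Continuous φ
  /-- `φ` is an open map -/
  isOpenMap : IsOpenMap φ

/-- The image of an open homomorphism is an open subgroup (part of the printed definition).
[cite: MochizukiFrdII2008, Ex 1.3 (ii) p.11] -/
theorem IsOpenHom.isOpen_range {φ : G₁ →* G₂} (h : IsOpenHom φ) : IsOpen (φ.range : Set G₂) := by
  rw [MonoidHom.coe_range]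
  exact h.isOpenMap.isOpen_range

variable (G₁ G₂)

/-- **Example 1.3 (ii)** (FrdII p. 11): an open homomorphism `φ : Π₁ → Π₂` of tempered groups "induces
a natural functor `φ_* : B^temp(Π₁)⁰ → B^temp(Π₂)⁰`", the composite of the orbit functor
`E ↦ E/Ker(φ)` (to `φ(Π₁)`-sets) with the functor `B^temp(φ(Π₁))⁰ → B^temp(Π₂)⁰` of (i); on the
connected objects `Π₁/H` (`H` open) it is `Π₁/H ↦ Π₂/φ(H)`. "When `φ` is surjective, one verifies
immediately that the functor `φ_*` is left adjoint to the pull-back functor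
`B^temp(Π₂)⁰ → B^temp(Π₁)⁰`." Typed as the existence of such a functor with the printed
adjunction (pull-back = restriction of L3's `BTemp.res` to connected parts).
[cite: MochizukiFrdII2008, Ex 1.3 (ii) p.11] -/
def PushforwardFunctor : Prop :=
  ∀ [IsTopologicalGroup G₁] [IsTopologicalGroup G₂] (φ : G₁ →* G₂) (hφ : IsOpenHom φ),
    IsTempered G₁ → IsTempered G₂ → Function.Surjective φ →
      ∃ (push : ConnectedPart (BTemp G₁) ⥤ ConnectedPart (BTemp G₂))
        (pull : ConnectedPart (BTemp G₂) ⥤ ConnectedPart (BTemp G₁)),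
        (pull ⋙ ObjectProperty.ι _ = ObjectProperty.ι _ ⋙ BTemp.res ⟨φ, hφ.continuous⟩) ∧
          Nonempty (push ⊣ pull)

end OpenHom

/-! ### Example 1.3 (iii): the functor to `B^temp(G_F)⁰` (pp. 11–12) -/

section Galois

variable (F : Type u) [Field F]

/-- **Example 1.3 (iii)** (FrdII pp. 11–12): for `F = ℚ_p` or `ℝ` with absolute Galois group `G_F`,
an open homomorphism `Π → Q` from a tempered `Π` (with open subgroup `Π°`) to a quotient
`G_F ↠ Q` "determines a functor `B^temp(Π, Π°)⁰ ↪ B^temp(Π)⁰ → B^temp(Q)⁰ ↪ B^temp(G_F)⁰` between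
connected, totally epimorphic categories of FSM-type"; for `F = ℚ_p` this is the functor
`D := B^temp(Π, Π°)⁰ → D₀ = B^temp(G_{ℚ_p})⁰` "which satisfies the hypotheses of Theorem 1.2, (i)".
Typed (for any field `F`, with `G_F := Field.absoluteGaloisGroup F`) as the existence of the composite
functor together with the three printed properties of its target.
[cite: MochizukiFrdII2008, Ex 1.3 (iii) pp.11-12] -/
def GaloisBaseFunctor : Prop :=
  ∀ (G : Type u) [Group G] [TopologicalSpace G] [IsTopologicalGroup G] (H : Subgroup G)
    (Q : Type u) [Group Q] [TopologicalSpace Q] [IsTopologicalGroup Q]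
    (φ : G →* Q) (π : Field.absoluteGaloisGroup F →* Q),
    IsTempered G → IsOpen (H : Set G) → IsOpenHom φ → Continuous π → Function.Surjective π →
      Nonempty (ConnectedPart (BTempRel G H) ⥤ ConnectedPart (BTemp (Field.absoluteGaloisGroup F))) ∧
        IsConnected (ConnectedPart (BTemp (Field.absoluteGaloisGroup F))) ∧
        IsTotallyEpimorphic (ConnectedPart (BTemp (Field.absoluteGaloisGroup F))) ∧
        IsOfFSMType (ConnectedPart (BTemp (Field.absoluteGaloisGroup F)))

end Galois

end QuasiTemperoid

end Literature.AlgebraicGeometry.Frobenioids
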